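import Summits.ResolutionOfSingularities.ResolutionOfSingularities.Theorems.PurelyInseparableDim4ResConeFrameStraighten
import HarnessLib
import HarnessLib.Audit.Tags

/-!
# Purely inseparable four-folds — FRAME BOOKKEEPING for the moving-frame end game: isolation under shears, FRAME ⇒
# VERTEX, and the quadratic jet's sources (K2(p) lane, SLICE C, brick (ii) «tilted reduction», FILE 3c-α;
# file-holder res-dim4-p-5 g4)

[OURS · counted 0 · cell `res-dim4-pi` · K2(p) lane, slice C (desk WORD #155) · seat p-5 g4.]
Nothing here proves K2(p)/K2(5), `NoIsolatedTrap p p` or resolution of singularities in dimension ≥ 4 / char. `p`.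

Pure algebra around the linear frames `shear_c Φ` and the inert quadratic jet `J : x_i ↦ x_i + Φ′_i x_c²`
(`Φ′_c = Φ′_d = 0`) of `…FrameConjugation` / `…FrameStraighten`:
* `isIsolated_shear_iff` — isolation is shear-invariant (p-11's `CoordChange.isIsolated_algEquiv_iff`);
* `shear_free_of_free`, **`single_mem_resVertex_of_shear`** — FRAME ⇒ VERTEX: if the degree-`o` rows of `shear_c Φ F`
  have `x_d`-exponent `r_d`, the residual cone is `x_d`-free and `e_d ∈ Vtx` (no tameness needed);
* `isWeightedHomogeneous_jet_X`, `isWeightedHomogeneous_jet_monomial`, `jet_source` — `J x^e` is weighted-homogeneous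
  for every weight `w` with `w_i = 2 w_c` on the jet letters, so a monomial `x^M` of `J x^e` has `M_d = e_d` and
  `M_c + 2|e| = e_c + 2|M|`;
* **`coeff_jet_eq_of_noSource`** — `coeff_M (J P) = coeff_M P` as soon as `P` has NO SOURCE for `M` (the (4,5)/(4,4)
  MARKER ROBUSTNESS of the tilted end game); `aeval_frame_eq_jet` — the full frame
  `Θ : x_i ↦ x_i + Φ_i x_c + Ψ_i x_d + Φ′_i x_c²` is `J ∘ shear_c Φ ∘ shear_d Ψ`; `eq_pair_add_single_of_degIn_eq_one`.
[cite: CossartJannsenSaito2020, Def. 2.8, Thm. 3.14] [cite: Hauser2010, §I (definition of P⁺)]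
bears_on: LADDER-RESOLUTION:D157-DOOR2 (res-dim4-pi · K2(p) = `RidgeBudget.NoAboveFloorTrap p p` · slice C, tilted residual).
Supports stmt-ResolutionOfSingularities-16155 (helper).
-/

set_option linter.dupNamespace false -- mandated namespace of this single-conjunct summit

noncomputable section

namespace Summit.ResolutionOfSingularities.ResolutionOfSingularities.Theorems.PIDim4

namespace ResCone

open MvPolynomial Finset
open Literature.AlgebraicGeometry.Resolution
open Literature.AlgebraicGeometry.Resolution.CentreBlowup
open Literature.AlgebraicGeometry.Resolution.Hauser2010
open Literature.AlgebraicGeometry.Resolution.HauserPerlega2019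
open PointBlowup (additiveSubspace)

variable {K : Type} [Field K]

section Iso

/-- **Isolation is invariant under a shear** (`t_j = 0`): the shear is an automorphism fixing the origin
(p-11 g3's `CoordChange.isIsolated_algEquiv_iff`). [OURS · bookkeeping] [cite: CossartJannsenSaito2020, Thm. 3.14] -/
theorem isIsolated_shear_iff (q : ℕ) (j : Fin 4) {t : Fin 4 → K} (ht : t j = 0) (F : MvPolynomial (Fin 4) K) :
    IsIsolated q (shear j t F) ↔ IsIsolated q F := by
  let f := aeval (R := K) fun i => if i = j then (X j : MvPolynomial (Fin 4) K) else X i + C (t i) * X j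
  let g := aeval (R := K) fun i => if i = j then (X j : MvPolynomial (Fin 4) K) else X i + C ((-t) i) * X j
  have hfg : ∀ P, f (g P) = P := fun P => by
    change shear j t (shear j (-t) P) = P
    rw [shear_shear j t (-t) (by rw [Pi.neg_apply, ht, neg_zero]), neg_add_cancel, shear_zero]
  have hgf : ∀ P, g (f P) = P := fun P => shear_neg_shear j ht P
  let τ : MvPolynomial (Fin 4) K ≃ₐ[K] MvPolynomial (Fin 4) K :=
    AlgEquiv.ofAlgHom f g (AlgHom.ext hfg) (AlgHom.ext hgf)
  have hτ : ∀ i, constantCoeff (τ (X i)) = 0 := fun i => by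
    change constantCoeff (f (X i)) = 0
    by_cases hij : i = j <;> simp [f, hij]
  exact CoordChange.isIsolated_algEquiv_iff q τ hτ F

end Iso

section Vertex

variable [DecidableEq K]

omit [DecidableEq K] in
/-- A shear along `x_c` creates no letter `x_d` (`d ≠ c`): an `x_d`-free polynomial stays `x_d`-free.
[folklore] -/
theorem shear_free_of_free {c d : Fin 4} (hdc : d ≠ c) (t : Fin 4 → K) {R : MvPolynomial (Fin 4) K}
    (hR : ∀ μ ∈ R.support, μ d = 0) : ∀ μ ∈ (shear c t R).support, μ d = 0 := by
  classical
  intro μ hμ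
  by_contra hne
  have hmem : d ∈ (shear c t R).vars :=
    (mem_vars_iff_mem_support d).mpr ⟨μ, hμ, Finsupp.mem_support_iff.mpr hne⟩
  rw [shear_eq_aeval, aeval_eq_bind₁] at hmem
  obtain ⟨i, hi, hdi⟩ := mem_vars_bind₁ _ _ hmem
  have hid : i ≠ d := by
    rintro rfl
    obtain ⟨ν, hν, hiν⟩ := (mem_vars_iff_mem_support i).mp hi
    exact (Finsupp.mem_support_iff.mp hiν) (hR ν hν)
  by_cases hic : i = c
  · rw [if_pos hic, vars_X, Finset.mem_singleton] at hdi
    exact hdc hdi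
  · rw [if_neg hic] at hdi
    rcases Finset.mem_union.mp (vars_add_subset _ _ hdi) with h | h
    · rw [vars_X, Finset.mem_singleton] at h
      exact hid h.symm
    · rcases Finset.mem_union.mp (vars_mul _ _ h) with h' | h'
      · rw [vars_C] at h'
        simp at h'
      · rw [vars_X, Finset.mem_singleton] at h'
        exact hdc h'

/-- **FRAME ⇒ VERTEX.** If, in a linear frame `x_i ↦ x_i + Φ_i x_c` free on the boundary (`Φ_c = 0`,
`Φ_i ≠ 0 ⇒ r_i = 0`), every degree-`o` monomial of the sheared `F` has `x_d`-exponent exactly `r_d` (`d ≠ c`), then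
the sheared residual cone is `x_d`-free, hence so is the cone itself (un-shearing along `x_c` creates no `x_d`), and
`e_d ∈ Vtx(s)`. [OURS · bookkeeping] [cite: CossartJannsenSaito2020, Def. 2.8] -/
theorem single_mem_resVertex_of_shear {s : State K} {o : ℕ} (ho : ordZero s.F = o)
    (hr : ∀ e ∈ s.F.support, s.r ≤ e) {c d : Fin 4} (hdc : d ≠ c) {Φ : Fin 4 → K} (hΦc : Φ c = 0)
    (hΦr : ∀ i, Φ i ≠ 0 → s.r i = 0)
    (hE : ∀ E ∈ (shear c Φ s.F).support, E.degree = o → E d = s.r d) :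
    (Pi.single d 1 : Fin 4 → K) ∈ resVertex s := by
  classical
  unfold resVertex
  apply single_mem_additiveSubspace_of_free
  have hro := degree_r_le ho hr
  have hR' : ∀ μ ∈ (shear c Φ (resForm s)).support, μ d = 0 := by
    intro μ hμ
    have hμdeg : μ.degree = o - s.r.degree := by
      have := isHomogeneous_shear c Φ (resForm_isHomogeneous ho) (MvPolynomial.mem_support_iff.mp hμ)
      rwa [weight_one_eq_degree] at this
    have hin : coeff (s.r + μ) (shear c Φ (initialForm s.F)) = coeff μ (shear c Φ (resForm s)) := by
      rw [← monomial_mul_resForm hr, shear_mul, shear_monomial_eq_of_free c hΦc hΦr, coeff_monomial_mul',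
        if_pos le_self_add, one_mul, add_tsub_cancel_left]
    have hdeg : (s.r + μ).degree = o := by rw [map_add, hμdeg]; omega
    have hF : s.r + μ ∈ (shear c Φ s.F).support := by
      rw [MvPolynomial.mem_support_iff, coeff_shear_eq_coeff_shear_initialForm_of_degree_eq c Φ ho hdeg, hin]
      exact MvPolynomial.mem_support_iff.mp hμ
    have := hE _ hF hdeg
    rw [Finsupp.add_apply] at this
    omega
  rw [← shear_neg_shear c hΦc (resForm s)]
  exact shear_free_of_free hdc (-Φ) hR'

end Vertex

section JetSource

/-- Each generator image `x_i + Φ′_i x_c²` is `w`-homogeneous of weight `w_i` when `w_i = 2 w_c` on the jet letters.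
[folklore] -/
theorem isWeightedHomogeneous_jet_X (c : Fin 4) (Φ' : Fin 4 → K) {w : Fin 4 → ℕ}
    (hw : ∀ i, Φ' i ≠ 0 → w i = 2 * w c) (i : Fin 4) :
    IsWeightedHomogeneous w ((X i : MvPolynomial (Fin 4) K) + C (Φ' i) * X c ^ 2) (w i) := by
  by_cases hi : Φ' i = 0
  · rw [hi, C_0, zero_mul, add_zero]; exact isWeightedHomogeneous_X K w i
  · refine (isWeightedHomogeneous_X K w i).add ?_
    have h := ((isWeightedHomogeneous_X K w c).pow 2).C_mul (Φ' i)
    rwa [smul_eq_mul, ← hw i hi] at h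

/-- `J x^e` is `w`-homogeneous of weight `w(e)` for every such weight. [folklore] -/
theorem isWeightedHomogeneous_jet_monomial (c : Fin 4) (Φ' : Fin 4 → K) {w : Fin 4 → ℕ}
    (hw : ∀ i, Φ' i ≠ 0 → w i = 2 * w c) (e : Fin 4 →₀ ℕ) :
    IsWeightedHomogeneous w
      (aeval (fun i => (X i : MvPolynomial (Fin 4) K) + C (Φ' i) * X c ^ 2) (monomial e (1 : K)))
      (Finsupp.weight w e) := by
  rw [aeval_monomial, map_one, one_mul, Finsupp.prod, Finsupp.weight_apply, Finsupp.sum]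
  exact IsWeightedHomogeneous.prod _ _ _ fun i _ => (isWeightedHomogeneous_jet_X c Φ' hw i).pow (e i)

/-- **SOURCES OF THE JET**: if `x^M` occurs in `J x^e` (`Φ′_c = Φ′_d = 0`, `c ≠ d`) then `M_d = e_d` and
`M_c + 2|e| = e_c + 2|M|` — the jet trades one jet letter for two `x_c`. [folklore] -/
theorem jet_source {c d : Fin 4} (hcd : c ≠ d) (Φ' : Fin 4 → K) (hΦ'c : Φ' c = 0) (hΦ'd : Φ' d = 0)
    {e M : Fin 4 →₀ ℕ}
    (h : coeff M (aeval (fun i => (X i : MvPolynomial (Fin 4) K) + C (Φ' i) * X c ^ 2) (monomial e (1 : K))) ≠ 0) :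
    M d = e d ∧ M c + 2 * e.degree = e c + 2 * M.degree := by
  classical
  have hw₂ : ∀ i, Φ' i ≠ 0 → (if i = d then 1 else 0 : ℕ) = 2 * (if c = d then 1 else 0) := fun i hi => by
    rw [if_neg hcd, if_neg (by rintro rfl; exact hi hΦ'd)]
  have h2 := isWeightedHomogeneous_jet_monomial c Φ' hw₂ e h
  have hw₁ : ∀ i, Φ' i ≠ 0 → (if i = c then 1 else 2 : ℕ) = 2 * (if c = c then 1 else 2) := fun i hi => by
    rw [if_pos rfl, if_neg (by rintro rfl; exact hi hΦ'c)]
  have h1 := isWeightedHomogeneous_jet_monomial c Φ' hw₁ e h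
  have hδ : ∀ m : Fin 4 →₀ ℕ, Finsupp.weight (fun i => if i = d then (1 : ℕ) else 0) m = m d := fun m => by
    rw [Finsupp.weight_apply, Finsupp.sum_fintype _ _ (fun i => by simp)]
    simp_rw [smul_eq_mul, mul_ite, mul_one, mul_zero]
    rw [Finset.sum_ite_eq' Finset.univ d, if_pos (Finset.mem_univ d)]
  have hγ : ∀ m : Fin 4 →₀ ℕ, Finsupp.weight (fun i => if i = c then (1 : ℕ) else 2) m + m c = 2 * m.degree := by
    intro m
    rw [Finsupp.weight_apply, Finsupp.sum_fintype _ _ (fun i => by simp), ← degIn_univ, degIn, Finset.mul_sum,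
      ← Finset.sum_erase_add _ _ (Finset.mem_univ c), ← Finset.sum_erase_add _ (fun i => 2 * m i) (Finset.mem_univ c),
      smul_eq_mul, if_pos rfl]
    have : ∑ i ∈ Finset.univ.erase c, m i • (if i = c then (1 : ℕ) else 2) = ∑ i ∈ Finset.univ.erase c, 2 * m i :=
      Finset.sum_congr rfl fun i hi => by rw [if_neg (Finset.ne_of_mem_erase hi), smul_eq_mul, mul_comm]
    rw [this]; ring
  refine ⟨by rw [← hδ M, ← hδ e, h2], ?_⟩
  have hM := hγ M
  have he := hγ e
  omega

/-- **NO SOURCE ⇒ THE JET DOES NOT CHANGE THE COEFFICIENT**: if no monomial `x^e` of `P` with `|e| < |M|`,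
`e_d = M_d` and `M_c + 2|e| = e_c + 2|M|` exists, then `coeff_M (J P) = coeff_M P`. [OURS · bookkeeping]
[cite: CossartJannsenSaito2020, Thm. 3.14] -/
theorem coeff_jet_eq_of_noSource {c d : Fin 4} (hcd : c ≠ d) (Φ' : Fin 4 → K) (hΦ'c : Φ' c = 0) (hΦ'd : Φ' d = 0)
    {P : MvPolynomial (Fin 4) K} {M : Fin 4 →₀ ℕ}
    (hno : ∀ e ∈ P.support, e.degree < M.degree → M d = e d → M c + 2 * e.degree = e c + 2 * M.degree → False) :
    coeff M (aeval (fun i => (X i : MvPolynomial (Fin 4) K) + C (Φ' i) * X c ^ 2) P) = coeff M P := by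
  classical
  conv_lhs => rw [P.as_sum]
  rw [map_sum, coeff_sum]
  conv_rhs => rw [P.as_sum, coeff_sum]
  refine Finset.sum_congr rfl fun e he => ?_
  rw [← mul_one (coeff e P), ← smul_eq_mul, ← smul_monomial, map_smul, coeff_smul, coeff_smul, coeff_monomial]
  by_cases hle : M.degree ≤ e.degree
  · rw [coeff_jet_monomial c Φ' e.degree e rfl M hle]
    by_cases h : e = M
    · rw [if_pos h, if_pos h.symm]
    · rw [if_neg h, if_neg (Ne.symm h)]
  · rw [if_neg (fun h : e = M => hle (by rw [h]))]
    by_cases hz : coeff M (aeval (fun i => (X i : MvPolynomial (Fin 4) K) + C (Φ' i) * X c ^ 2)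
        (monomial e (1 : K))) = 0
    · rw [hz]
    · obtain ⟨hd, hc⟩ := jet_source hcd Φ' hΦ'c hΦ'd hz
      exact (hno e he (by omega) hd hc).elim

/-- **The full frame is the jet after the two shears**: `Θ = J ∘ shear_c Φ ∘ shear_d Ψ` on polynomials,
`Θ : x_i ↦ x_i + Φ_i x_c + Ψ_i x_d + Φ′_i x_c²` (tilts vanishing at `c`, `d`). [folklore] -/
theorem aeval_frame_eq_jet {c d : Fin 4} (hcd : c ≠ d) {Φ Ψ Φ' : Fin 4 → K} (hΦc : Φ c = 0) (hΦd : Φ d = 0)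
    (hΨc : Ψ c = 0) (hΨd : Ψ d = 0) (hΦ'c : Φ' c = 0) (hΦ'd : Φ' d = 0) (F : MvPolynomial (Fin 4) K) :
    aeval (fun i => (X i : MvPolynomial (Fin 4) K) + C (Φ i) * X c + C (Ψ i) * X d + C (Φ' i) * X c ^ 2) F =
      aeval (fun i => (X i : MvPolynomial (Fin 4) K) + C (Φ' i) * X c ^ 2) (shear c Φ (shear d Ψ F)) := by
  rw [shear_eq_aeval, shear_eq_aeval, ← AlgHom.comp_apply, ← AlgHom.comp_apply]
  congr 1
  have hdc : d ≠ c := fun h => hcd h.symm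
  refine MvPolynomial.algHom_ext fun i => ?_
  simp only [AlgHom.comp_apply, aeval_X]
  by_cases hic : i = c
  · subst hic; simp [hcd, hΦc, hΨc, hΦ'c]
  · by_cases hid : i = d
    · subst hid; simp [hic, hΦd, hΨd, hΦ'd]
    · simp [hic, hid, hdc, hΦ'c, hΦd, hΦ'd]
      ring

/-- An exponent with exactly ONE inert letter (counted with multiplicity) is `u e_a + v e_{a′} + e_i`. [folklore] -/
theorem eq_pair_add_single_of_degIn_eq_one {a a' : Fin 4} (haa : a ≠ a') {e : Fin 4 →₀ ℕ}
    (h : degIn ((Finset.univ.erase a).erase a') e = 1) :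
    ∃ i, i ≠ a ∧ i ≠ a' ∧ e = Finsupp.single a (e a) + Finsupp.single a' (e a') + Finsupp.single i 1 := by
  classical
  set P := (Finset.univ.erase a).erase a' with hP
  unfold degIn at h
  obtain ⟨i, hiP, hi⟩ : ∃ i ∈ P, e i ≠ 0 := by
    by_contra hno
    push Not at hno
    rw [Finset.sum_eq_zero hno] at h
    exact zero_ne_one h
  have hia' : i ≠ a' := Finset.ne_of_mem_erase hiP
  have hia : i ≠ a := Finset.ne_of_mem_erase (Finset.mem_of_mem_erase hiP)
  have hsum := Finset.sum_erase_add P (fun j => e j) hiP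
  have hle : e i ≤ 1 := by rw [← h, ← hsum]; exact Nat.le_add_left _ _
  have hei : e i = 1 := by omega
  have hrest : ∀ j ∈ P, j ≠ i → e j = 0 := fun j hj hji => by
    have h0 : ∑ j ∈ P.erase i, e j = 0 := by omega
    exact Finset.sum_eq_zero_iff.mp h0 j (Finset.mem_erase.mpr ⟨hji, hj⟩)
  refine ⟨i, hia, hia', ?_⟩
  ext l
  rw [Finsupp.add_apply, two_apply haa, Finsupp.single_apply]
  by_cases hla : l = a
  · rw [if_pos hla, if_neg (fun h => hia (h.trans hla)), hla, add_zero]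
  · rw [if_neg hla]
    by_cases hla' : l = a'
    · rw [if_pos hla', if_neg (fun h => hia' (h.trans hla')), hla', add_zero]
    · rw [if_neg hla']
      by_cases hli : i = l
      · rw [if_pos hli, ← hli, hei]
      · rw [if_neg hli, zero_add]
        exact hrest l (Finset.mem_erase.mpr ⟨hla', Finset.mem_erase.mpr ⟨hla, Finset.mem_univ l⟩⟩) (Ne.symm hli)

end JetSource

end ResCone

end Summit.ResolutionOfSingularities.ResolutionOfSingularities.Theorems.PIDim4

end
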